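import Literature.MathematicalPhysics.QuantumLattice.PlaquetteBreathingSpaceGroup
import Literature.MathematicalPhysics.QuantumLattice.PairFieldSelectionRule
import HarnessLib

/-!
# `d`-wave selection rules on the breathing (plaquette) Hubbard torus

Topic `MathematicalPhysics/QuantumLattice`, family `hubbard`; sequel of `PlaquetteBreathingSpaceGroup`
and `PairFieldSelectionRule` (written for the crux `CooperPairDMott` of route `CooperPairDMottWalk`,
summit `HubbardSuperconductivity`, whose clause (c) asserts a MACROSCOPIC `d_{x²-y²}` pair amplitude
`z L² ‖φ₀‖² ‖φ₂‖² ≤ |⟨φ₂, Δ_d φ₀⟩|²` between the half-filled and the two-hole sector ground states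
of the breathing torus `H_L(a,b,U) = hamiltonian (G ∖ P) a U + hamiltonian (G ⊓ P) b 0`, and whose
kill criterion (ii) is "pair momentum `(π,π)` ⟹ clause (c) false"). Contents, all PROVED:

* generic linear algebra of such amplitude bounds: both sides scale by `|c₀|²|c₂|²` under
  `φ₀ ↦ c₀ φ₀`, `φ₂ ↦ c₂ φ₂`, so when the ground states of BOTH sectors are unique up to scalars
  the bound for ONE pair of ground states gives it for ALL pairs (`amplitudeBound_forall_of_exists`);
  a symmetry preserving the sector ground states acts by a scalar on a non-degenerate one
  (`exists_eigenvalue_of_unique_groundState`); and the abstract kill criterion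
  (`matrixElement_eq_zero_and_not_amplitudeBound`, from Wigner's selection rule
  `dotProduct_mulVec_eq_zero_of_twisted_eigen`): an isometry `V` with `V Δ = c Δ V` and
  `V`-eigenvectors `φ₀`, `φ₂` with `μ ≠ c λ` force `⟨φ₂, Δ φ₀⟩ = 0`, so NO bound with a positive
  constant holds;
* on the breathing torus (`breathing_dWave_selectionRule`): for a plaquette-compatible space-group
  element `(γ, v)` (file `PlaquetteBreathingSpaceGroup`), if the sector ground states `(N₀,M₀)`,
  `(N₂,M₂)` of `H_L(a,b,U)` are unique they are eigenvectors of `U_γ U_v` with eigenvalues `λ`,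
  `μ`, and `⟨φ₂, Δ_d φ₀⟩ = 0` UNLESS `μ = χ_{B₁g}(γ) λ` (`spaceGroup_mul_pairField_dWave`);
  specialised to the three generators for even `L`: plaquette translations `U_{2eⱼ}` — nonzero pair
  (crystal) momentum relative to the parent kills the amplitude (`breathing_dWave_momentum_selectionRule`);
  the plaquette-centred rotation, `χ_{B₁g}(r) = -1` — a two-hole ground state not `B₁g` RELATIVE to
  the parent kills it (`breathing_dWave_rotation_selectionRule`); the plaquette-centred axis
  reflection, `χ = +1` (`breathing_dWave_reflection_selectionRule`).

Which quantum numbers the ground states of the breathing torus actually carry is not decided here.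

Sources: D. J. Scalapino, Phys. Rep. 250 (1995) 329, §2 eqs. (2.2)–(2.3) [Scalapino1995];
D. J. Scalapino, S. A. Trugman, Philos. Mag. B 74 (1996) 607 (`d_{x²-y²}` symmetry of the plaquette
pair operator); E. P. Wigner, *Group Theory* (1959), ch. 12 (selection rules; folklore). No
definition and no named fact is introduced.
-/

noncomputable section

namespace Literature.MathematicalPhysics.QuantumLattice

open Matrix Finset
open Literature.Probability.LatticeModels
open scoped ComplexOrder

/-! ### Scaling of the two sides of clause (c); the reduction to ONE pair of ground states -/

section Abstract

variable {n : Type*} [Fintype n]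

/-- `Re ⟨cψ, cψ⟩ = |c|² Re ⟨ψ, ψ⟩`. [folklore] -/
theorem re_star_smul_dotProduct_smul (c : ℂ) (ψ : n → ℂ) :
    (star (c • ψ) ⬝ᵥ (c • ψ)).re = ‖c‖ ^ 2 * (star ψ ⬝ᵥ ψ).re := by
  rw [star_smul, smul_dotProduct, dotProduct_smul, smul_smul, smul_eq_mul, Complex.star_def,
    Complex.conj_mul', ← Complex.ofReal_pow, Complex.re_ofReal_mul]

/-- `|⟨c₂ χ, Δ (c₀ φ)⟩|² = |c₀|² |c₂|² |⟨χ, Δ φ⟩|²`. [folklore] -/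
theorem norm_sq_matrixElement_smul (Δ : Matrix n n ℂ) (c₀ c₂ : ℂ) (φ χ : n → ℂ) :
    ‖star (c₂ • χ) ⬝ᵥ (Δ *ᵥ (c₀ • φ))‖ ^ 2 =
      ‖c₀‖ ^ 2 * ‖c₂‖ ^ 2 * ‖star χ ⬝ᵥ (Δ *ᵥ φ)‖ ^ 2 := by
  rw [mulVec_smul, star_smul, smul_dotProduct, dotProduct_smul, smul_smul, smul_eq_mul, norm_mul,
    norm_mul, Complex.star_def, Complex.norm_conj]
  ring

/-- **Reduction of clause (c) to ONE pair of ground states.** If the ground states of `H` in the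
sectors `(N₀, M₀)` and `(N₂, M₂)` are both unique up to scalars, then the homogeneous amplitude
bound `C · Re⟨φ₀,φ₀⟩ · Re⟨φ₂,φ₂⟩ ≤ |⟨φ₂, Δ φ₀⟩|²` for ONE pair of sector ground states implies it
for EVERY pair (both sides scale by `|c₀|²|c₂|²`). [folklore] -/
theorem amplitudeBound_forall_of_exists {Λ : Type*} [LinearOrder Λ] [Fintype Λ]
    (H Δ : Matrix (Finset (Orb Λ)) (Finset (Orb Λ)) ℂ) (N₀ N₂ : ℕ) (M₀ M₂ C : ℝ)
    (h₀ : ∀ φ φ', IsGroundStateInSector H N₀ M₀ φ → IsGroundStateInSector H N₀ M₀ φ' →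
      ∃ c : ℂ, φ' = c • φ)
    (h₂ : ∀ φ φ', IsGroundStateInSector H N₂ M₂ φ → IsGroundStateInSector H N₂ M₂ φ' →
      ∃ c : ℂ, φ' = c • φ)
    (hex : ∃ ψ₀ ψ₂, IsGroundStateInSector H N₀ M₀ ψ₀ ∧ IsGroundStateInSector H N₂ M₂ ψ₂ ∧
      C * (star ψ₀ ⬝ᵥ ψ₀).re * (star ψ₂ ⬝ᵥ ψ₂).re ≤ ‖star ψ₂ ⬝ᵥ (Δ *ᵥ ψ₀)‖ ^ 2) :
    ∀ φ₀ φ₂, IsGroundStateInSector H N₀ M₀ φ₀ → IsGroundStateInSector H N₂ M₂ φ₂ →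
      C * (star φ₀ ⬝ᵥ φ₀).re * (star φ₂ ⬝ᵥ φ₂).re ≤ ‖star φ₂ ⬝ᵥ (Δ *ᵥ φ₀)‖ ^ 2 := by
  obtain ⟨ψ₀, ψ₂, hψ₀, hψ₂, hb⟩ := hex
  intro φ₀ φ₂ hφ₀ hφ₂
  obtain ⟨c₀, rfl⟩ := h₀ ψ₀ φ₀ hψ₀ hφ₀
  obtain ⟨c₂, rfl⟩ := h₂ ψ₂ φ₂ hψ₂ hφ₂
  rw [re_star_smul_dotProduct_smul, re_star_smul_dotProduct_smul, norm_sq_matrixElement_smul]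
  have h := mul_le_mul_of_nonneg_left hb (by positivity : (0 : ℝ) ≤ ‖c₀‖ ^ 2 * ‖c₂‖ ^ 2)
  calc C * (‖c₀‖ ^ 2 * (star ψ₀ ⬝ᵥ ψ₀).re) * (‖c₂‖ ^ 2 * (star ψ₂ ⬝ᵥ ψ₂).re)
      = ‖c₀‖ ^ 2 * ‖c₂‖ ^ 2 * (C * (star ψ₀ ⬝ᵥ ψ₀).re * (star ψ₂ ⬝ᵥ ψ₂).re) := by ring
    _ ≤ ‖c₀‖ ^ 2 * ‖c₂‖ ^ 2 * ‖star ψ₂ ⬝ᵥ (Δ *ᵥ ψ₀)‖ ^ 2 := h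

/-- **A symmetry acts by a scalar on a non-degenerate sector ground state.** If `V` maps sector
ground states of `H` in `(N, M)` to sector ground states and the sector ground state is unique up
to scalars, every ground state is a `V`-eigenvector. [folklore] -/
theorem exists_eigenvalue_of_unique_groundState {Λ : Type*} [LinearOrder Λ] [Fintype Λ]
    (H V : Matrix (Finset (Orb Λ)) (Finset (Orb Λ)) ℂ) (N : ℕ) (M : ℝ)
    (hV : ∀ ψ, IsGroundStateInSector H N M ψ → IsGroundStateInSector H N M (V *ᵥ ψ))
    (huniq : ∀ φ φ', IsGroundStateInSector H N M φ → IsGroundStateInSector H N M φ' →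
      ∃ c : ℂ, φ' = c • φ)
    {φ : Fock (Orb Λ)} (hφ : IsGroundStateInSector H N M φ) : ∃ lam : ℂ, V *ᵥ φ = lam • φ :=
  huniq φ (V *ᵥ φ) hφ (hV φ hφ)

/-- The eigenvalue of a NONZERO eigenvector of an inner-product preserving map is unimodular.
[folklore] -/
theorem star_mul_self_eq_one_of_eigen_ne_zero (V : Matrix n n ℂ) (mu : ℂ) (χ : n → ℂ)
    (hV : ∀ x y : n → ℂ, star (V *ᵥ x) ⬝ᵥ (V *ᵥ y) = star x ⬝ᵥ y)
    (hχ : V *ᵥ χ = mu • χ) (hχ0 : χ ≠ 0) : star mu * mu = 1 := by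
  have h := hV χ χ
  rw [hχ, star_smul, smul_dotProduct, dotProduct_smul, smul_smul, smul_eq_mul] at h
  have hne : star χ ⬝ᵥ χ ≠ 0 := fun h0 => hχ0 (dotProduct_star_self_eq_zero.1 h0)
  exact mul_right_cancel₀ hne (h.trans (one_mul _).symm)

/-- **Selection rule ⇒ clause (c) fails (abstract kill criterion).** If `V` preserves inner
products and twists `Δ` by the scalar `c` (`V Δ = c • Δ V`), and the nonzero vectors `φ₀`, `φ₂`
are `V`-eigenvectors with eigenvalues `lam`, `mu`, `mu ≠ c · lam`, then `⟨φ₂, Δ φ₀⟩ = 0`; in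
particular NO bound `w · Re⟨φ₀,φ₀⟩ · Re⟨φ₂,φ₂⟩ ≤ |⟨φ₂, Δ φ₀⟩|²` with `w > 0` can hold.
[folklore] -/
theorem matrixElement_eq_zero_and_not_amplitudeBound (V Δ : Matrix n n ℂ) (c lam mu : ℂ)
    (φ₀ φ₂ : n → ℂ) (hV : ∀ x y : n → ℂ, star (V *ᵥ x) ⬝ᵥ (V *ᵥ y) = star x ⬝ᵥ y)
    (hΔ : V * Δ = c • (Δ * V)) (h₀ : V *ᵥ φ₀ = lam • φ₀) (h₂ : V *ᵥ φ₂ = mu • φ₂)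
    (hφ₀ : φ₀ ≠ 0) (hφ₂ : φ₂ ≠ 0) (hne : mu ≠ c * lam) :
    star φ₂ ⬝ᵥ (Δ *ᵥ φ₀) = 0 ∧
      ∀ w : ℝ, 0 < w → ¬ (w * (star φ₀ ⬝ᵥ φ₀).re * (star φ₂ ⬝ᵥ φ₂).re ≤
        ‖star φ₂ ⬝ᵥ (Δ *ᵥ φ₀)‖ ^ 2) := by
  have hmu : star mu * mu = 1 := star_mul_self_eq_one_of_eigen_ne_zero V mu φ₂ hV h₂ hφ₂
  have hne' : star mu * c * lam ≠ 1 := by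
    intro h1
    apply hne
    calc mu = mu * (star mu * c * lam) := by rw [h1, mul_one]
      _ = (star mu * mu) * (c * lam) := by ring
      _ = c * lam := by rw [hmu, one_mul]
  have hzero : star φ₂ ⬝ᵥ (Δ *ᵥ φ₀) = 0 :=
    dotProduct_mulVec_eq_zero_of_twisted_eigen V Δ c lam mu φ₀ φ₂ hV hΔ h₀ h₂ hne'
  refine ⟨hzero, fun w hw hle => ?_⟩
  rw [hzero, norm_zero, zero_pow two_ne_zero] at hle
  have hp₀ : 0 < (star φ₀ ⬝ᵥ φ₀).re := by
    have h := (Matrix.dotProduct_star_self_pos_iff (v := φ₀)).2 hφ₀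
    exact (Complex.pos_iff.1 h).1
  have hp₂ : 0 < (star φ₂ ⬝ᵥ φ₂).re := by
    have h := (Matrix.dotProduct_star_self_pos_iff (v := φ₂)).2 hφ₂
    exact (Complex.pos_iff.1 h).1
  have : 0 < w * (star φ₀ ⬝ᵥ φ₀).re * (star φ₂ ⬝ᵥ φ₂).re := by positivity
  linarith

end Abstract

/-! ### Notation (verbatim the route's `Hb L a b U`) -/

/-- The "different plaquette" relation `P` on the fermionic torus, as in the route statement. -/
local notation "Pq[" L "]" =>
  (SimpleGraph.comap (fun (x : FermionTorus 2 L) (i : Fin 2) => (ofLex x i : ℕ) / 2)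
    (⊤ : SimpleGraph (Fin 2 → ℕ)))

/-- The breathing Hamiltonian `H_L(a, b, U)`, verbatim the route's `Hb L a b U`. -/
local notation "Hb[" L "," a "," b "," U "]" =>
  (hamiltonian (fermionTorusGraph 2 L \ Pq[L]) a U + hamiltonian (fermionTorusGraph 2 L ⊓ Pq[L]) b 0)

section SelectionRules

variable {L : ℕ} [NeZero L]

/-- **SELECTION RULE FOR THE `d`-WAVE PAIR AMPLITUDE ON THE BREATHING TORUS** (the machinery of
kill criterion (ii) of route `CooperPairDMottWalk`). Let `(γ, v)` be a plaquette-compatible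
space-group element (`U = U_γ U_v` commutes with `H_L(a,b,U)`), and suppose the ground states of
`H_L(a,b,U)` in the sectors `(N₀, M₀)` and `(N₂, M₂)` are both unique up to scalars. Then the ground
states `φ₀`, `φ₂` are `U`-eigenvectors, `U φ₀ = λ φ₀`, `U φ₂ = μ φ₂`, and UNLESS `μ = χ_{B₁g}(γ) λ`
the `d`-wave pair amplitude `⟨φ₂, Δ_d φ₀⟩` vanishes identically — so no clause-(c) bound
`w ‖φ₀‖² ‖φ₂‖² ≤ |⟨φ₂, Δ_d φ₀⟩|²` with `w > 0` can hold (pair momentum `(π,π)` in plaquette units: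
`γ = 1`, `v = 2e₁`, `μ = -λ`; wrong `C₄` character: `γ = r`, `μ ≠ -λ`).
[cite: Scalapino1995, §2 eq. (2.3)] -/
theorem breathing_dWave_selectionRule (γ : DihedralGroup 4) (v : TorusSite 2 L)
    (hP : ∀ x y : FermionTorus 2 L,
      ((fun i : Fin 2 => (ofLex (FermionTorus.ofTorusEquiv
          ((d4SitePerm γ : Equiv.Perm (TorusSite 2 L)) * Equiv.addRight v) x) i : ℕ) / 2) =
        fun i : Fin 2 => (ofLex (FermionTorus.ofTorusEquiv
          ((d4SitePerm γ : Equiv.Perm (TorusSite 2 L)) * Equiv.addRight v) y) i : ℕ) / 2) ↔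
      ((fun i : Fin 2 => (ofLex x i : ℕ) / 2) = fun i : Fin 2 => (ofLex y i : ℕ) / 2))
    (a b U : ℝ) {N₀ N₂ : ℕ} {M₀ M₂ : ℝ}
    (h₀ : ∀ φ φ', IsGroundStateInSector Hb[L,a,b,U] N₀ M₀ φ →
      IsGroundStateInSector Hb[L,a,b,U] N₀ M₀ φ' → ∃ c : ℂ, φ' = c • φ)
    (h₂ : ∀ φ φ', IsGroundStateInSector Hb[L,a,b,U] N₂ M₂ φ →
      IsGroundStateInSector Hb[L,a,b,U] N₂ M₂ φ' → ∃ c : ℂ, φ' = c • φ)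
    {φ₀ φ₂ : Fock (Orb (FermionTorus 2 L))}
    (hφ₀ : IsGroundStateInSector Hb[L,a,b,U] N₀ M₀ φ₀)
    (hφ₂ : IsGroundStateInSector Hb[L,a,b,U] N₂ M₂ φ₂) :
    ∃ lam mu : ℂ,
      ((fockD4 (L := L) γ).val * (fockTranslate v).val) *ᵥ φ₀ = lam • φ₀ ∧
      ((fockD4 (L := L) γ).val * (fockTranslate v).val) *ᵥ φ₂ = mu • φ₂ ∧
      (mu ≠ b1gChar γ * lam →
        star φ₂ ⬝ᵥ (pairField dWaveFormFactor L *ᵥ φ₀) = 0 ∧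
          ∀ w : ℝ, 0 < w → ¬ (w * (star φ₀ ⬝ᵥ φ₀).re * (star φ₂ ⬝ᵥ φ₂).re ≤
            ‖star φ₂ ⬝ᵥ (pairField dWaveFormFactor L *ᵥ φ₀)‖ ^ 2)) := by
  obtain ⟨lam, hlam⟩ := exists_eigenvalue_of_unique_groundState _
    ((fockD4 (L := L) γ).val * (fockTranslate v).val) N₀ M₀
    (fun ψ hψ => isGroundStateInSector_spaceGroup_mulVec_breathing γ v hP a b U hψ) h₀ hφ₀
  obtain ⟨mu, hmu⟩ := exists_eigenvalue_of_unique_groundState _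
    ((fockD4 (L := L) γ).val * (fockTranslate v).val) N₂ M₂
    (fun ψ hψ => isGroundStateInSector_spaceGroup_mulVec_breathing γ v hP a b U hψ) h₂ hφ₂
  exact ⟨lam, mu, hlam, hmu, fun hne =>
    matrixElement_eq_zero_and_not_amplitudeBound _ (pairField dWaveFormFactor L) (b1gChar γ) lam mu
      φ₀ φ₂ (star_spaceGroup_mulVec_dotProduct γ v) (spaceGroup_mul_pairField_dWave γ v) hlam hmu
      hφ₀.2.1 hφ₂.2.1 hne⟩

/-- **Pair (crystal) momentum selection rule on the breathing torus.** For even `L`, if the sector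
ground states `(N₀,M₀)`, `(N₂,M₂)` of `H_L(a,b,U)` are unique, they are eigenvectors of the
plaquette translation `U_{2eⱼ}` with eigenvalues `λ`, `μ`, and `⟨φ₂, Δ_d φ₀⟩ = 0` unless `μ = λ`
(zero pair momentum relative to the parent); in the mismatched case clause (c) fails for every
`w > 0`. [cite: Scalapino1995, §2 eq. (2.3)] -/
theorem breathing_dWave_momentum_selectionRule (hL : Even L) (j : Fin 2) (a b U : ℝ)
    {N₀ N₂ : ℕ} {M₀ M₂ : ℝ}
    (h₀ : ∀ φ φ', IsGroundStateInSector Hb[L,a,b,U] N₀ M₀ φ →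
      IsGroundStateInSector Hb[L,a,b,U] N₀ M₀ φ' → ∃ c : ℂ, φ' = c • φ)
    (h₂ : ∀ φ φ', IsGroundStateInSector Hb[L,a,b,U] N₂ M₂ φ →
      IsGroundStateInSector Hb[L,a,b,U] N₂ M₂ φ' → ∃ c : ℂ, φ' = c • φ)
    {φ₀ φ₂ : Fock (Orb (FermionTorus 2 L))}
    (hφ₀ : IsGroundStateInSector Hb[L,a,b,U] N₀ M₀ φ₀)
    (hφ₂ : IsGroundStateInSector Hb[L,a,b,U] N₂ M₂ φ₂) :
    ∃ lam mu : ℂ,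
      (fockTranslate (Pi.single j ((2 : ℕ) : ZMod L))).val *ᵥ φ₀ = lam • φ₀ ∧
      (fockTranslate (Pi.single j ((2 : ℕ) : ZMod L))).val *ᵥ φ₂ = mu • φ₂ ∧
      (mu ≠ lam →
        star φ₂ ⬝ᵥ (pairField dWaveFormFactor L *ᵥ φ₀) = 0 ∧
          ∀ w : ℝ, 0 < w → ¬ (w * (star φ₀ ⬝ᵥ φ₀).re * (star φ₂ ⬝ᵥ φ₂).re ≤
            ‖star φ₂ ⬝ᵥ (pairField dWaveFormFactor L *ᵥ φ₀)‖ ^ 2)) := by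
  have h := breathing_dWave_selectionRule 1 (Pi.single j ((2 : ℕ) : ZMod L))
    (plaq_spaceGroup_translate_two_single hL j) a b U h₀ h₂ hφ₀ hφ₂
  rw [map_one, b1gChar_one] at h
  simpa only [Submonoid.coe_one, Matrix.one_mul, one_mul] using h

/-- **`C₄`-character selection rule on the breathing torus** (plaquette-centred rotation
`x ↦ (1 - x₂, x₁)`, `U = U_r U_{-e₂}`, `χ_{B₁g}(r) = -1`). For even `L`, if the sector ground
states are unique they are `U`-eigenvectors with eigenvalues `λ`, `μ`, and `⟨φ₂, Δ_d φ₀⟩ = 0`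
unless `μ = -λ` (`φ₂` is `B₁g` = `d_{x²-y²}` RELATIVE to `φ₀`); otherwise clause (c) fails.
[cite: Scalapino1995, §2 eq. (2.3)] -/
theorem breathing_dWave_rotation_selectionRule (hL : Even L) (a b U : ℝ)
    {N₀ N₂ : ℕ} {M₀ M₂ : ℝ}
    (h₀ : ∀ φ φ', IsGroundStateInSector Hb[L,a,b,U] N₀ M₀ φ →
      IsGroundStateInSector Hb[L,a,b,U] N₀ M₀ φ' → ∃ c : ℂ, φ' = c • φ)
    (h₂ : ∀ φ φ', IsGroundStateInSector Hb[L,a,b,U] N₂ M₂ φ →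
      IsGroundStateInSector Hb[L,a,b,U] N₂ M₂ φ' → ∃ c : ℂ, φ' = c • φ)
    {φ₀ φ₂ : Fock (Orb (FermionTorus 2 L))}
    (hφ₀ : IsGroundStateInSector Hb[L,a,b,U] N₀ M₀ φ₀)
    (hφ₂ : IsGroundStateInSector Hb[L,a,b,U] N₂ M₂ φ₂) :
    ∃ lam mu : ℂ,
      ((fockD4 (L := L) (DihedralGroup.r 1)).val *
          (fockTranslate (-(Pi.single 1 1 : TorusSite 2 L))).val) *ᵥ φ₀ = lam • φ₀ ∧
      ((fockD4 (L := L) (DihedralGroup.r 1)).val *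
          (fockTranslate (-(Pi.single 1 1 : TorusSite 2 L))).val) *ᵥ φ₂ = mu • φ₂ ∧
      (mu ≠ -lam →
        star φ₂ ⬝ᵥ (pairField dWaveFormFactor L *ᵥ φ₀) = 0 ∧
          ∀ w : ℝ, 0 < w → ¬ (w * (star φ₀ ⬝ᵥ φ₀).re * (star φ₂ ⬝ᵥ φ₂).re ≤
            ‖star φ₂ ⬝ᵥ (pairField dWaveFormFactor L *ᵥ φ₀)‖ ^ 2)) := by
  have h := breathing_dWave_selectionRule (DihedralGroup.r 1) (-(Pi.single 1 1 : TorusSite 2 L))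
    (plaq_plaquetteRot hL) a b U h₀ h₂ hφ₀ hφ₂
  have hχ : b1gChar (DihedralGroup.r 1) = -1 := by
    show ((-1 : ℂ) ^ (1 : ZMod 4).val) = -1
    rw [show (1 : ZMod 4).val = 1 from rfl, pow_one]
  simpa only [hχ, neg_one_mul] using h

/-- **Axis-reflection selection rule on the breathing torus** (plaquette-centred reflection
`x ↦ (x₁, 1 - x₂)`, `U = U_s U_{-e₂}`, `χ_{B₁g}(s) = +1`): `⟨φ₂, Δ_d φ₀⟩ = 0` unless `μ = λ`.
[cite: Scalapino1995, §2 eq. (2.3)] -/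
theorem breathing_dWave_reflection_selectionRule (hL : Even L) (a b U : ℝ)
    {N₀ N₂ : ℕ} {M₀ M₂ : ℝ}
    (h₀ : ∀ φ φ', IsGroundStateInSector Hb[L,a,b,U] N₀ M₀ φ →
      IsGroundStateInSector Hb[L,a,b,U] N₀ M₀ φ' → ∃ c : ℂ, φ' = c • φ)
    (h₂ : ∀ φ φ', IsGroundStateInSector Hb[L,a,b,U] N₂ M₂ φ →
      IsGroundStateInSector Hb[L,a,b,U] N₂ M₂ φ' → ∃ c : ℂ, φ' = c • φ)
    {φ₀ φ₂ : Fock (Orb (FermionTorus 2 L))}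
    (hφ₀ : IsGroundStateInSector Hb[L,a,b,U] N₀ M₀ φ₀)
    (hφ₂ : IsGroundStateInSector Hb[L,a,b,U] N₂ M₂ φ₂) :
    ∃ lam mu : ℂ,
      ((fockD4 (L := L) (DihedralGroup.sr 0)).val *
          (fockTranslate (-(Pi.single 1 1 : TorusSite 2 L))).val) *ᵥ φ₀ = lam • φ₀ ∧
      ((fockD4 (L := L) (DihedralGroup.sr 0)).val *
          (fockTranslate (-(Pi.single 1 1 : TorusSite 2 L))).val) *ᵥ φ₂ = mu • φ₂ ∧
      (mu ≠ lam →
        star φ₂ ⬝ᵥ (pairField dWaveFormFactor L *ᵥ φ₀) = 0 ∧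
          ∀ w : ℝ, 0 < w → ¬ (w * (star φ₀ ⬝ᵥ φ₀).re * (star φ₂ ⬝ᵥ φ₂).re ≤
            ‖star φ₂ ⬝ᵥ (pairField dWaveFormFactor L *ᵥ φ₀)‖ ^ 2)) := by
  have h := breathing_dWave_selectionRule (DihedralGroup.sr 0) (-(Pi.single 1 1 : TorusSite 2 L))
    (plaq_plaquetteRefl hL) a b U h₀ h₂ hφ₀ hφ₂
  have hχ : b1gChar (DihedralGroup.sr 0) = 1 := by
    show ((-1 : ℂ) ^ (0 : ZMod 4).val) = 1
    norm_num
  simpa only [hχ, one_mul] using h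

end SelectionRules

end Literature.MathematicalPhysics.QuantumLattice

end
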